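import Summits.CriticalPhenomena.Ising3DConformalLimit.Theorems.HyperoctahedralRPExistsScaleCovariantLimitBlockCovAlgebra
import Literature.Probability.LatticeModels.CriticalBlockMoments
import HarnessLib

/-!
# The critical plus measure computes the block sums (stub `stub_blockModel`, line `Sketch`, crux `JoiningsTransfer`)

Crux `Summit.CriticalPhenomena.Ising3DConformalLimit.Theses.SynchronousCoupling.JoiningsTransfer`
(item stmt-CriticalPhenomena-18764, route `SynchronousCoupling`, sub-problem
`CriticalPhenomena/Ising3DConformalLimit`), line `Sketch`, stub C `stub_blockModel` (model identification).

The dictionary between the critical plus Gibbs measure and the lattice sums of line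
`monotone-blocking-port`: the plus measure `μ` of `exists_plusMeasure_holds` at `β = β_c(3)`, `h = 0` is a
translation-invariant Ising Gibbs PROBABILITY measure on `{±1}^{ℤ³}` with `spinCorr μ = plusCorr 3 β_c 0`, hence

* every critical correlator is a `μ`-integral, `criticalCorr 3 n y = ∫ ∏ᵢ σ_{yᵢ} dμ`
  (`criticalCorr_eq_integral_spinMonomial`);
* the block variance is the second moment of the block spin, `V(L) = blockCov L 0 = ∫ (Σ_{x ∈ cube L} σ_x)² dμ`
  (expand the square, integrate termwise, `criticalCorr_two_pair`, `blockCov_zero_eq`);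
* the normalised block moment is the `μ`-moment of the normalised shifted block spins,
  `critBlockMoment n L k⃗ = ∫ ∏ᵢ (V(L)^{-1/2} Σ_{x ∈ cube L} σ_{x + L kᵢ}) dμ`
  (`Finset.prod_univ_sum`, termwise integration, and `(√V)⁻¹ ^ n = (V^{n/2})⁻¹` for `V ≥ 0`).

Sources: S. Friedli, Y. Velenik, *Statistical Mechanics of Lattice Systems* (CUP 2017), Thm. 3.17, Thm. 6.26
(the plus state is a translation-invariant Gibbs measure, linear on local observables). No named facts. [folklore]
-/

noncomputable section

namespace Summit.CriticalPhenomena.Ising3DConformalLimit.Cruxes.JoiningsTransfer.Sketch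

open Literature.Probability.LatticeModels MeasureTheory Filter Set
open scoped Topology BigOperators
open Summit.CriticalPhenomena.Ising3DConformalLimit.Cruxes.ExistsScaleCovariantLimit.MonotoneBlockingPort

/-! ## Scalar and lattice helpers -/

/-- `S / V^{n/2} = (√V)⁻¹ ^ n · S` for `V ≥ 0` (also at `V = 0`, with the junk conventions `√0 = 0`,
`0⁻¹ = 0`, `0 ^ 0 = 1`). [folklore] -/
private theorem stub_blockModel_div_rpow_half_eq {V : ℝ} (hV : 0 ≤ V) (S : ℝ) (n : ℕ) :
    S / V ^ ((n : ℝ) / 2) = (Real.sqrt V)⁻¹ ^ n * S := by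
  rw [inv_pow, Real.sqrt_eq_rpow, ← Real.rpow_natCast, ← Real.rpow_mul hV,
    show (1 / (2 : ℝ)) * (n : ℝ) = (n : ℝ) / 2 by ring, div_eq_mul_inv, mul_comm]

/-- `V(L) = blockCov L 0 ≥ 0` (Griffiths: every critical two-point function is `≥ 0`). [folklore] -/
private theorem stub_blockModel_blockCov_zero_nonneg (L : ℕ) : 0 ≤ blockCov L 0 := by
  rw [blockCov_zero_eq]
  exact Finset.sum_nonneg fun x _ => Finset.sum_nonneg fun y _ => criticalTwoPoint_nonneg' _

/-- The square of the block spin is a double sum of pair monomials: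
`(Σ_{x ∈ cube L} σ_x)² = Σ_{a,b ∈ cube L} σ_a σ_b`. [folklore] -/
private theorem stub_blockModel_blockSpin_sq (L : ℕ) (σ : SpinConfig (Site 3)) :
    (∑ x ∈ cube L, spinAt x σ) ^ 2 = ∑ a ∈ cube L, ∑ b ∈ cube L, spinMonomial ![a, b] σ := by
  rw [sq, Finset.sum_mul_sum]
  refine Finset.sum_congr rfl fun a _ => Finset.sum_congr rfl fun b _ => ?_
  simp [spinMonomial, Fin.prod_univ_two]

/-- The product of the normalised shifted block spins is `(√V)⁻¹ ^ n` times a sum of spin monomials over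
`n`-tuples of the block: `∏ᵢ (c Σ_{x ∈ cube L} σ_{x + L kᵢ}) = cⁿ Σ_{p ∈ (cube L)ⁿ} ∏ᵢ σ_{pᵢ + L kᵢ}`. [folklore] -/
private theorem stub_blockModel_prod_blockSpin (n L : ℕ) (k : Fin n → Site 3) (c : ℝ)
    (σ : SpinConfig (Site 3)) :
    ∏ i, (c * ∑ x ∈ cube L, spinAt (x + (L : ℤ) • k i) σ) =
      c ^ n * ∑ p ∈ Fintype.piFinset (fun _ : Fin n => cube L),
        spinMonomial (fun i => p i + (L : ℤ) • k i) σ := by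
  rw [Finset.prod_mul_distrib, Fin.prod_const, Finset.prod_univ_sum]
  rfl

/-! ## The stub -/

/-- **Stub C (model identification).** There is a translation-invariant critical Ising Gibbs probability
measure `μ` on `{±1}^{ℤ³}` (the plus measure at `β_c`, `h = 0`) computing every critical correlator as
`∫ ∏ᵢ σ_{yᵢ} dμ`, the block variance `V(L) = blockCov L 0` as `∫ (Σ_{x ∈ cube L} σ_x)² dμ`, and the normalised
block moment `critBlockMoment n L k⃗` as `∫ ∏ᵢ (V(L)^{-1/2} Σ_{x ∈ cube L} σ_{x + L kᵢ}) dμ`.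
[cite: FriedliVelenik2017, Thm. 3.17 and Thm. 6.26] -/
theorem stub_blockModel : ∃ μ : Measure (SpinConfig (Site 3)),
    μ ∈ isingGibbsMeasures 3 (criticalBeta 3) 0 ∧ IsTranslationInvariantMeasure μ ∧ IsProbabilityMeasure μ ∧
    (∀ (n : ℕ) (y : Fin n → Site 3), criticalCorr 3 n y = ∫ σ, spinMonomial y σ ∂μ) ∧
    (∀ L : ℕ, blockCov L 0 = ∫ σ, (∑ x ∈ cube L, spinAt x σ) ^ 2 ∂μ) ∧
    (∀ (n L : ℕ) (k : Fin n → Site 3), critBlockMoment n L k =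
      ∫ σ, ∏ i, ((Real.sqrt (blockCov L 0))⁻¹ * ∑ x ∈ cube L, spinAt (x + (L : ℤ) • k i) σ) ∂μ) := by
  obtain ⟨μ, hμG, hTI, hcorr⟩ :=
    exists_plusMeasure_holds (d := 3) (β := criticalBeta 3) (h := (0 : ℝ)) (criticalBeta_nonneg 3)
  haveI hP : IsProbabilityMeasure μ := ((mem_isingGibbsMeasures_iff 3 _ 0 μ).1 hμG).isProbabilityMeasure
  -- every spin monomial is bounded by `1`, hence integrable
  have hint : ∀ (n : ℕ) (y : Fin n → Site 3), Integrable (spinMonomial y) μ := fun n y =>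
    Integrable.of_bound (measurable_spinMonomial y).aestronglyMeasurable 1
      (Eventually.of_forall fun s => by
        rw [Real.norm_eq_abs]
        simp [spinMonomial, Finset.abs_prod])
  -- conjunct 4: the critical correlators are `μ`-integrals
  have c4 : ∀ (n : ℕ) (y : Fin n → Site 3), criticalCorr 3 n y = ∫ σ, spinMonomial y σ ∂μ :=
    fun n y => criticalCorr_eq_integral_spinMonomial hcorr y
  refine ⟨μ, hμG, hTI, hP, c4, fun L => ?_, fun n L k => ?_⟩
  · -- conjunct 5: `V(L) = ∫ (block spin)²`
    simp only [stub_blockModel_blockSpin_sq]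
    rw [integral_finsetSum _ fun a _ => integrable_finsetSum _ fun b _ => hint 2 ![a, b],
      blockCov_zero_eq]
    refine Finset.sum_congr rfl fun a _ => ?_
    rw [integral_finsetSum _ fun b _ => hint 2 ![a, b]]
    refine Finset.sum_congr rfl fun b _ => ?_
    rw [← c4 2 ![a, b], criticalCorr_two_pair]
  · -- conjunct 6: `R_n(L; k) = ∫ ∏ᵢ (normalised shifted block spins)`
    simp only [stub_blockModel_prod_blockSpin]
    rw [integral_const_mul, integral_finsetSum _ fun p _ => hint n _, critBlockMoment,
      stub_blockModel_div_rpow_half_eq (stub_blockModel_blockCov_zero_nonneg L)]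
    congr 1
    exact Finset.sum_congr rfl fun p _ => c4 n _

end Summit.CriticalPhenomena.Ising3DConformalLimit.Cruxes.JoiningsTransfer.Sketch

end
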